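import Mathlib
import HarnessLib
import Summits.FinalStateConjecture.Statement
import Literature.Geometry.Lorentzian.LandauLifshitzPseudotensor
import Summits.FinalStateConjecture.FinalStateConjecture.Theorems.EIHFluxBalanceInertialRecessionStubPseudotensorBoundMatrix
import Summits.FinalStateConjecture.FinalStateConjecture.Theorems.EIHFluxBalanceInertialRecessionStubPseudotensorBoundEm
import Summits.FinalStateConjecture.FinalStateConjecture.Theorems.EIHFluxBalanceInertialRecessionStubPseudotensorBoundRicci
import Summits.FinalStateConjecture.FinalStateConjecture.Theorems.EIHFluxBalanceInertialRecessionStubPseudotensorBoundAlgebra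
import Summits.FinalStateConjecture.FinalStateConjecture.Theorems.EIHFluxBalanceInertialRecessionStubPseudotensorBoundBounds

/-!
# Stub `stub_pseudotensorBound` of line `sublinear-is-free-clean-window-charges`
# (crux `InertialRecession`, `stmt-FinalStateConjecture-10166`)

**Landau–Lifshitz (96.8)/(96.9) in bound form.** There is a universal constant `C` such that for
every field of bilinear forms `g` on `E4` which is `C²` at `x`, symmetric near `x`, with
`‖g x − η‖ ≤ 1/2` and `‖Dg(x) v‖ ≤ b‖v‖`, the pseudotensor density satisfies
`|det(g_{μν}(x)) · t^{μν}_LL(x)| ≤ C b²` — although both `Σ_α ∂_α h^{μνα}` and `(−g) G^{μν}/(8π)` in the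
DEFINITION (96.5)–(96.7) of `t_LL` (`LandauLifshitzPseudotensor.lean`) contain second derivatives of
`g`, these cancel identically (LL's lemma (96.1)–(96.4)), leaving a quadratic form in `∂g` with
coefficients polynomial in `g^{μν}` and `det g`.

Proof (parts 1–6 of this series): part 1 — `‖g x − η‖ ≤ 1/2` gives `det ≠ 0`, `|g^{μν}| ≤ 2`,
`|det| ≤ 243/2`, and `|∂g| ≤ b`; parts 2–4 — pointwise `C²` calculus expands `emComplex` and
`einsteinUpper` at `x` into explicit polynomials in the `2`-jet (Jacobi's formula, derivative of the
inverse, `Γ`, `∂Γ`, `Ric = tr R`); part 5 — the `∂∂g`-linear parts cancel in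
`−emComplex − (8π)⁻¹ det·G` (a polynomial identity in symmetric `g^{μν}`, `∂∂g`, verified by `ring`,
after an exact-rational numerical check, job `ptb-symbolcheck`); part 6 — the quadratic remainder is
at most `7713792 b²`. Hence `C = 7713792`.

Source: L. D. Landau, E. M. Lifshitz, *The Classical Theory of Fields*, §96, (96.5)–(96.9)
(key `LandauLifshitz1975`); L. Blanchet, Living Rev. Relativ., arXiv:1310.1528, §2.
-/

noncomputable section

set_option linter.dupNamespace false
set_option linter.unusedSimpArgs false
set_option maxSynthPendingDepth 3
set_option maxRecDepth 16384

open Filter Set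
open scoped Topology Matrix

namespace Summit.FinalStateConjecture.FinalStateConjecture.Theorems.SublinearIsFree.PseudotensorBound

open Literature.Geometry.Lorentzian Literature.Geometry.Lorentzian.LandauLifshitz

/-- The coordinate vectors `∂_μ` (local shorthand). -/
local notation "𝐞" => E4.basisVector

/-- **Stub `stub_pseudotensorBound`** (Landau–Lifshitz (96.8)/(96.9) in bound form): a universal `C`
with `|det(g_{μν}(x)) · t^{μν}_LL(x)| ≤ C b²` whenever `g` is `C²` at `x`, symmetric near `x`,
`‖g x − η‖ ≤ 1/2` and `‖Dg(x) v‖ ≤ b ‖v‖`; here `C = 7713792`.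
[cite: LandauLifshitz1975, §96 (96.9)] -/
theorem stub_pseudotensorBound :
    (∃ C : ℝ, 0 ≤ C ∧ ∀ (g : E4 → E4 →L[ℝ] E4 →L[ℝ] ℝ) (x : E4) (b : ℝ), ContDiffAt ℝ 2 g x → (∀ᶠ y in 𝓝 x, ∀ v w : E4, g y v w = g y w v) → ‖g x - Minkowski.bilin‖ ≤ 1 / 2 → (∀ v : E4, ‖fderiv ℝ g x v‖ ≤ b * ‖v‖) → ∀ μ ν : Fin 4, |LandauLifshitz.metricDet g x * LandauLifshitz.pseudotensor g x μ ν| ≤ C * b ^ 2) := by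
  refine ⟨7713792, by norm_num, fun g x b hg hs hη hb μ ν ↦ ?_⟩
  have hdet : metricDet g x ≠ 0 := metricDet_ne_zero hη
  have hD : |metricDet g x| ≤ 243 / 2 := abs_metricDet_le hη
  have hu : ∀ i j, |upper g x i j| ≤ 2 := abs_upper_le hη
  have hd : ∀ a i j, |fderiv ℝ g x (𝐞 a) (𝐞 i) (𝐞 j)| ≤ b := abs_fderiv_basis_le hb
  have hsx : ∀ v w : E4, g x v w = g x w v := hs.self_of_nhds
  have hus : ∀ i j, upper g x i j = upper g x j i := fun i j ↦ upper_comm hsx j i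
  have hdd₁ : ∀ a c i j, fderiv ℝ (fderiv ℝ g) x (𝐞 a) (𝐞 c) (𝐞 i) (𝐞 j)
      = fderiv ℝ (fderiv ℝ g) x (𝐞 c) (𝐞 a) (𝐞 i) (𝐞 j) :=
    fun a c i j ↦ by rw [fderiv_fderiv_comm hg (𝐞 a) (𝐞 c)]
  have hdd₂ : ∀ a c i j, fderiv ℝ (fderiv ℝ g) x (𝐞 a) (𝐞 c) (𝐞 i) (𝐞 j)
      = fderiv ℝ (fderiv ℝ g) x (𝐞 a) (𝐞 c) (𝐞 j) (𝐞 i) :=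
    fun a c i j ↦ fderiv_fderiv_symm hg hs _ _ _ _
  have hsplit := einsteinRaw_split (upper g x) (fun a i j ↦ fderiv ℝ g x (𝐞 a) (𝐞 i) (𝐞 j))
    (fun a c i j ↦ fderiv ℝ (fderiv ℝ g) x (𝐞 a) (𝐞 c) (𝐞 i) (𝐞 j)) μ ν
  have hden := density_identity (metricDet g x) (upper g x)
    (fun a i j ↦ fderiv ℝ g x (𝐞 a) (𝐞 i) (𝐞 j))
    (fun a c i j ↦ fderiv ℝ (fderiv ℝ g) x (𝐞 a) (𝐞 c) (𝐞 i) (𝐞 j)) hus hdd₁ hdd₂ μ ν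
  have hbd := abs_density_le (metricDet g x) (upper g x)
    (fun a i j ↦ fderiv ℝ g x (𝐞 a) (𝐞 i) (𝐞 j)) hD hu hd μ ν
  beta_reduce at hsplit hden hbd
  rw [metricDet_mul_pseudotensor hdet, emComplex_eq_twoJet hg hdet, einsteinUpper_eq_twoJet hg hs hdet,
    hsplit, hden]
  exact hbd

end Summit.FinalStateConjecture.FinalStateConjecture.Theorems.SublinearIsFree.PseudotensorBound

end
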